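import Literature.AlgebraicGeometry.Resolution.LogRegularScheme
import Mathlib.RingTheory.RegularLocalRing.Defs
import HarnessLib

set_option linter.dupNamespace false -- mandated namespace of this single-conjunct summit

/-!
# Log regular charts with few generators of Kato's ideal are regular

Crux `Picover` (stmt-ResolutionOfSingularities-0554), line `giraud-separated-base`, stub
`isRegularLocalRing_of_isLogRegularLocal_of_span` (the terminal pointwise step of Kato 1994,
(10.4): once the fan is subdivided so that the chart monoids are free, log regular = regular).

**Setting.** `R` a Noetherian local ring, `φ : P → (R, ·)` a chart by a monoid `P ⊆ ℤⁿ`,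
`I = nonunitIdeal P φ` Kato's ideal (generated by the images of the non-unit chart elements),
`F = unitFace P φ` the face of units, `r = rank_ℤ Fᵍᵖ`.  Kato's condition (2.1)
(`LogChart.IsLogRegularLocal`): `R ⧸ I` is a regular local ring and `dim R = dim (R ⧸ I) + (n − r)`.

**Claim.** If moreover `I` is generated by a finite set `q` with `|q| + r ≤ n`, then `R` is a
regular local ring.

**Proof** (counting generators). Lift a minimal generating set of `𝔪_{R/I}` (of size
`embdim (R/I) = dim (R/I)`, regularity) to a finite set `T ⊆ R`; then
`𝔪_R = (T) + I = (T ∪ q)` (pull back `𝔪_{R/I} = (T)·(R/I)` along `R → R/I`, whose kernel is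
`I = (q)`), so `embdim R ≤ |T| + |q| ≤ dim (R/I) + (n − r) = dim R`, and `R` is regular
(`IsRegularLocalRing.of_spanFinrank_maximalIdeal_le`).
-/

noncomputable section

open Literature.AlgebraicGeometry.Resolution IsLocalRing

universe u

namespace Summit.ResolutionOfSingularities.ResolutionOfSingularities.Theorems.Picover.LogRegularFreeChart

/-- **Generators of `𝔪_R` from generators of `𝔪_{R/I}` and of `I`.** For a local ring `R` and an
ideal `I = (q)` with `R ⧸ I` Noetherian, the maximal ideal of `R` needs at most
`embdim (R ⧸ I) + |q|` generators: `𝔪_R = (T) + (q)` for any lift `T` of a generating set of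
`𝔪_{R/I}`. [folklore] -/
theorem spanFinrank_maximalIdeal_le_add_card {R : Type u} [CommRing R] [IsLocalRing R]
    (I : Ideal R) [IsLocalRing (R ⧸ I)] [IsNoetherianRing (R ⧸ I)] (q : Finset R)
    (hI : I = Ideal.span (q : Set R)) :
    (maximalIdeal R).spanFinrank ≤ (maximalIdeal (R ⧸ I)).spanFinrank + q.card := by
  classical
  -- a minimal generating set `s'` of `𝔪_{R/I}` and a lift `T` of it to `R`
  obtain ⟨s', hcard, hspan⟩ := Submodule.FG.exists_span_finset_card_eq_spanFinrank
    (maximalIdeal (R ⧸ I)).fg_of_isNoetherianRing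
  set mk : R →+* R ⧸ I := Ideal.Quotient.mk I with hmk
  have hsurj : Function.Surjective mk := Ideal.Quotient.mk_surjective
  set T : Finset R := s'.image (Function.surjInv hsurj) with hT
  have hTimage : (mk : R → R ⧸ I) '' (T : Set R) = (s' : Set (R ⧸ I)) := by
    rw [hT, Finset.coe_image, Set.image_image]
    simp only [Function.surjInv_eq hsurj, Set.image_id']
  -- `𝔪_R` is the pull-back of `𝔪_{R/I} = (mk '' T)` along `mk`, i.e. `(T) + I = (T ∪ q)`
  have hcomap : (maximalIdeal (R ⧸ I)).comap mk = maximalIdeal R :=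
    eq_maximalIdeal (Ideal.comap_isMaximal_of_surjective mk hsurj)
  have hker : Ideal.comap mk ⊥ = Ideal.span (q : Set R) := by
    rw [← RingHom.ker_eq_comap_bot, hmk, Ideal.mk_ker]
    exact hI
  have hspan' : maximalIdeal (R ⧸ I) = (Ideal.span (T : Set R)).map mk := by
    rw [Ideal.map_span, hTimage]
    exact hspan.symm
  have hmax : maximalIdeal R = Ideal.span ((T ∪ q : Finset R) : Set R) := by
    rw [← hcomap, hspan', Ideal.comap_map_of_surjective mk hsurj, hker, Finset.coe_union,
      Ideal.span_union]
  -- count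
  calc (maximalIdeal R).spanFinrank
      = (Ideal.span ((T ∪ q : Finset R) : Set R)).spanFinrank := by rw [hmax]
    _ ≤ ((T ∪ q : Finset R) : Set R).ncard :=
        Submodule.spanFinrank_span_le_ncard_of_finite (Finset.finite_toSet _)
    _ = (T ∪ q).card := Set.ncard_coe_finset _
    _ ≤ T.card + q.card := Finset.card_union_le _ _
    _ ≤ s'.card + q.card := Nat.add_le_add_right Finset.card_image_le _
    _ = (maximalIdeal (R ⧸ I)).spanFinrank + q.card := by rw [hcard]

/-- **Kato's terminal step in its simplest algebraic form** (Kato 1994, (10.4) with (2.1)): let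
`φ : P → (R, ·)` be a chart through a Noetherian local ring `R` by a monoid `P ⊆ ℤⁿ`, log regular
in the sense of Kato (2.1) (`LogChart.IsLogRegularLocal`: `R ⧸ I` regular and
`dim R = dim (R ⧸ I) + (n − rank_ℤ Fᵍᵖ)`, `I = nonunitIdeal P φ`, `F = unitFace P φ`). If Kato's
ideal `I` is generated by a finite set `q` with `|q| + rank_ℤ Fᵍᵖ ≤ n` (as happens for a FREE
chart monoid `P ≅ F ⊕ ℕ^s`, `I` generated by the `s` basis images), then `R` is a regular local
ring: `embdim R ≤ embdim (R ⧸ I) + |q| = dim (R ⧸ I) + |q| ≤ dim R`.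
[cite: Kato1994, (10.4) and Def. (2.1)] -/
theorem isRegularLocalRing_of_isLogRegularLocal_of_span : ∀ {R : Type u} [CommRing R] [IsNoetherianRing R] [IsLocalRing R] {n : ℕ} (P : AddSubmonoid (Fin n → ℤ)) (φ : Multiplicative P →* R) (q : Finset R), LogChart.IsLogRegularLocal P φ → LogChart.nonunitIdeal P φ = Ideal.span (q : Set R) → q.card + Module.finrank ℤ (Submodule.span ℤ ((fun v : P => (v : Fin n → ℤ)) '' LogChart.unitFace P φ)) ≤ n → IsRegularLocalRing R := by
  intro R _ _ _ n P φ q h hI hq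
  obtain ⟨hreg, hdim⟩ := h
  -- generators: `embdim R ≤ embdim (R/I) + |q|`
  have hle : (maximalIdeal R).spanFinrank ≤
      (maximalIdeal (R ⧸ LogChart.nonunitIdeal P φ)).spanFinrank + q.card :=
    spanFinrank_maximalIdeal_le_add_card (LogChart.nonunitIdeal P φ) q hI
  -- `|q| ≤ n − rank_ℤ Fᵍᵖ`
  have hq' : q.card ≤ n - Module.finrank ℤ
      (Submodule.span ℤ ((fun v : P => (v : Fin n → ℤ)) '' LogChart.unitFace P φ)) := by
    omega
  refine IsRegularLocalRing.of_spanFinrank_maximalIdeal_le R ?_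
  calc ((maximalIdeal R).spanFinrank : WithBot ℕ∞)
      ≤ (((maximalIdeal (R ⧸ LogChart.nonunitIdeal P φ)).spanFinrank + q.card : ℕ) :
          WithBot ℕ∞) := by exact_mod_cast hle
    _ = ((maximalIdeal (R ⧸ LogChart.nonunitIdeal P φ)).spanFinrank : WithBot ℕ∞) +
          (q.card : WithBot ℕ∞) := by push_cast; rfl
    _ ≤ ringKrullDim (R ⧸ LogChart.nonunitIdeal P φ) +
          ((n - Module.finrank ℤ (Submodule.span ℤ
            ((fun v : P => (v : Fin n → ℤ)) '' LogChart.unitFace P φ)) : ℕ) : WithBot ℕ∞) :=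
        add_le_add (le_of_eq IsRegularLocalRing.spanFinrank_maximalIdeal) (by exact_mod_cast hq')
    _ = ringKrullDim R := hdim.symm

end Summit.ResolutionOfSingularities.ResolutionOfSingularities.Theorems.Picover.LogRegularFreeChart

end
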